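import Summits.ABC.ABC.Theses.CubicResolventAllowance
import Summits.ABC.ABC.Theorems.CubicResolventAllowanceResolventDiscBounds
import Literature.NumberTheory.DiophantineGeometry.GenEllThm21With
import HarnessLib

/-!
# STUB-IDEAS k1 · gen 18 — companion sketch for `stub_complexCubic` (crux stmt-ABC-22740 `IndexSzpiro`)

Purpose: cut the recognition theorem **C6** of the certificate chain (`abcWithExponent_eight_of_stub`,
`Cruxes/IndexSzpiro/StubIdeas1G6Sketch.lean`, M-sized) into prover-cycle pieces whose hypotheses are the
∀-closed statements of the number-theoretic helpers C1 (irreducibility), T5 (capture `z² ∣ 6912·Δ_min`),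
C4 (conductor support) and T4a (stem field), so that the remaining work is

* `pencilMemberBound_of_parts` (C6a, M⁻: real arithmetic only — stub + LANDED `resolventDiscBounds_proof`),
* `rad_roles` (C6c, S: the radical of the three role assignments is `rad(abc)`),
* `abcWithExponent_eight_of_pencilMemberBound` (C6b, S: role bookkeeping `c ≤ 2·max(a,b)`, `√`),

and the composition `abcWithExponent_eight_of_stub'` is kernel-checked here. `Stub`, `SignDoor`, `pencilInt`,
`pencil`, `pencil_Δ`, `pencil_isElliptic` are VERBATIM copies from the G6 sketch (kept local so this file
elaborates stand-alone). Nothing here proves the stub; the chain proves `Stub ⟹ abc with exponent 8`.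
-/

set_option linter.dupNamespace false

noncomputable section

namespace Summit.ABC.ABC.Cruxes.IndexSzpiro.StubIdeas1G18

open Polynomial UniqueFactorizationMonoid WeierstrassCurve
open Literature.NumberTheory.DiophantineGeometry

/-- The stub, verbatim (payload `stub.signature`). -/
def Stub : Prop :=
  ∀ ε : ℝ, 0 < ε → ∃ C : ℝ, ∀ (W : WeierstrassCurve ℚ) [W.IsElliptic] (K : Type) [Field K] [NumberField K],
    Irreducible W.twoTorsionPolynomial.toPoly → Module.finrank ℚ K = 3 →
    (∃ θ : K, aeval θ W.twoTorsionPolynomial.toPoly = 0) → NumberField.discr K < 0 →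
    (W.minimalDiscriminantNorm ℤ : ℝ) ≤ C * |(NumberField.discr K : ℝ)| * (W.conductorNorm ℤ : ℝ) ^ (6 + ε)

/-- The sign door (G5 `discr_neg_iff_Δ_neg`, kernel-checked there; consumed as a hypothesis). [folklore] -/
def SignDoor : Prop :=
  ∀ (W : WeierstrassCurve ℚ) [W.IsElliptic] (K : Type) [Field K] [NumberField K],
    Irreducible W.twoTorsionPolynomial.toPoly → Module.finrank ℚ K = 3 →
    (∃ θ : K, aeval θ W.twoTorsionPolynomial.toPoly = 0) → W.Δ < 0 → NumberField.discr K < 0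

/-- The pure-cubic pencil `E_{x,y} : Y² = X³ + 108xy·X + 216xy(y − x)` (copy of G6). -/
def pencilInt (x y : ℤ) : WeierstrassCurve ℤ := ⟨0, 0, 0, 108 * x * y, 216 * x * y * (y - x)⟩

/-- `E_{x,y}` over `ℚ` (copy of G6). -/
abbrev pencil (x y : ℤ) : WeierstrassCurve ℚ := (pencilInt x y).baseChange ℚ

/-- `Δ(E_{x,y}) = −2¹⁰·3⁹·(xy(x+y))²` (copy of G6 T1b, kernel-checked). [folklore] -/
theorem pencilInt_Δ (x y : ℤ) : (pencilInt x y).Δ = -(2 ^ 10 * 3 ^ 9) * (x * y * (x + y)) ^ 2 := by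
  simp only [pencilInt, WeierstrassCurve.Δ, WeierstrassCurve.b₂, WeierstrassCurve.b₄, WeierstrassCurve.b₆,
    WeierstrassCurve.b₈]
  ring

/-- `Δ(E_{x,y}/ℚ)` (copy of G6 T1b′, kernel-checked). [folklore] -/
theorem pencil_Δ (x y : ℤ) :
    (pencil x y).Δ = -(2 ^ 10 * 3 ^ 9 : ℚ) * ((x : ℚ) * y * (x + y)) ^ 2 := by
  rw [pencil, WeierstrassCurve.baseChange, WeierstrassCurve.map_Δ, pencilInt_Δ, eq_intCast]
  push_cast
  ring

/-- `E_{x,y}` is elliptic for `xy(x+y) ≠ 0` (copy of G6 T1c, kernel-checked). [folklore] -/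
theorem pencil_isElliptic {x y : ℤ} (hx : x ≠ 0) (hy : y ≠ 0) (hz : x + y ≠ 0) :
    (pencil x y).IsElliptic := by
  refine ⟨?_⟩
  rw [pencil_Δ, isUnit_iff_ne_zero]
  have hx' : (x : ℚ) ≠ 0 := by exact_mod_cast hx
  have hy' : (y : ℚ) ≠ 0 := by exact_mod_cast hy
  have hz' : ((x : ℚ) + y) ≠ 0 := by exact_mod_cast hz
  exact mul_ne_zero (by norm_num) (pow_ne_zero 2 (mul_ne_zero (mul_ne_zero hx' hy') hz'))

/-! ## The ∀-closed helper statements (= C1, T5, C4, T4a of the G6 chain, as hypotheses) -/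

/-- C1∀: `ψ₂(E_{x,y})` is irreducible when `xy²` is not a rational cube (G6 `pencil_irreducible`, M). -/
def PencilIrreducible : Prop :=
  ∀ x y : ℤ, x ≠ 0 → y ≠ 0 → x + y ≠ 0 → (∀ r : ℚ, r ^ 3 ≠ (x : ℚ) * y ^ 2) →
    Irreducible (pencil x y).twoTorsionPolynomial.toPoly

/-- T5∀: the captured member `(x+y)² ∣ 6912·Δ_min(E_{x,y})` (G6 `sq_dvd_mul_minimalDiscriminantNorm`, S∘S). -/
def PencilCapture : Prop :=
  ∀ (x y : ℤ) [(pencil x y).IsElliptic], IsCoprime x y → x ≠ 0 → y ≠ 0 → x + y ≠ 0 →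
    ((x + y) ^ 2).natAbs ∣ 6912 * (pencil x y).minimalDiscriminantNorm ℤ

/-- C4∀: `N(E_{x,y}) ∣ 2⁸3⁵·rad(xy(x+y))²` (G6 `conductorNorm_pencil_dvd`, M). -/
def PencilConductor : Prop :=
  ∀ (x y : ℤ) [(pencil x y).IsElliptic], IsCoprime x y → x ≠ 0 → y ≠ 0 → x + y ≠ 0 →
    (pencil x y).conductorNorm ℤ ∣ 2 ^ 8 * 3 ^ 5 * (radical (x * y * (x + y))).natAbs ^ 2

/-- T4a∀: an irreducible 2-division cubic has a cubic stem field (G6 `exists_cubicField`, PROVED there). -/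
def StemField : Prop :=
  ∀ W : WeierstrassCurve ℚ, Irreducible W.twoTorsionPolynomial.toPoly →
    ∃ (K : Type) (_ : Field K) (_ : NumberField K),
      Module.finrank ℚ K = 3 ∧ ∃ θ : K, aeval θ W.twoTorsionPolynomial.toPoly = 0

/-- T7∀: the FLT(3) dispatch (G6 `flt3_dispatch`, S). -/
def Flt3Dispatch : Prop :=
  ∀ a b c : ℕ, IsABCTriple a b c →
    (∀ r : ℚ, r ^ 3 ≠ (a : ℚ) * (b : ℚ) ^ 2) ∨
      ((∀ r : ℚ, r ^ 3 ≠ (c : ℚ) * (-(a : ℚ)) ^ 2) ∧ ∀ r : ℚ, r ^ 3 ≠ (c : ℚ) * (-(b : ℚ)) ^ 2)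

/-! ## The new cut of C6 -/

/-- **The pencil-member bound**: for coprime `x, y` with `xy(x+y) ≠ 0` and `xy²` not a cube,
`(x + y)² ≤ A(ε)·rad(xy(x+y))^{16+2ε}`. -/
def PencilMemberBound : Prop :=
  ∀ ε : ℝ, 0 < ε → ∃ A : ℝ, 0 < A ∧ ∀ x y : ℤ, IsCoprime x y → x ≠ 0 → y ≠ 0 → x + y ≠ 0 →
    (∀ r : ℚ, r ^ 3 ≠ (x : ℚ) * y ^ 2) →
    (((x + y) ^ 2 : ℤ) : ℝ) ≤ A * (((radical (x * y * (x + y))).natAbs : ℕ) : ℝ) ^ (16 + 2 * ε)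

/-- **C6a (M⁻, real arithmetic only).** `Stub ⟹ PencilMemberBound` given the four ∀-helpers and the sign door:
`z² ≤ 6912·Δ_min ≤ 6912·C·|d_K|·N^{6+ε} ≤ 6912·1944·C·N^{8+ε} ≤ 6912·1944·C·(2⁸3⁵)^{8+ε}·rad^{16+2ε}`
(`resolventDiscBounds_proof.1`: `|d_K| ≤ 1944·N²`; `minimalDiscriminantNorm_pos_holds`, `conductorNorm_pos_holds`,
`radical_ne_zero` for `Nat.le_of_dvd`; `Real.rpow_add`, `Real.mul_rpow`, `Real.rpow_le_rpow`). [folklore] -/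
theorem pencilMemberBound_of_parts (hirr : PencilIrreducible) (hcap : PencilCapture) (hcond : PencilConductor)
    (hstem : StemField) (hsign : SignDoor) (h : Stub) : PencilMemberBound := by
  sorry

/-- **C6c (S).** The three role assignments have radical `rad(abc)`: `x·y·(x+y) ∈ {abc, −abc}` and
`radical` is invariant under units (`radical_eq_of_associated` / `Int.natAbs`), `ℤ → ℕ` transfer by
`Int.natAbs` of a product of the `ℕ`-prime factors. [folklore] -/
theorem rad_roles {a b c : ℕ} (h : IsABCTriple a b c) :
    (radical ((a : ℤ) * b * ((a : ℤ) + b))).natAbs = rad a b c ∧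
    (radical ((c : ℤ) * (-(a : ℤ)) * ((c : ℤ) + -(a : ℤ)))).natAbs = rad a b c ∧
    (radical ((c : ℤ) * (-(b : ℤ)) * ((c : ℤ) + -(b : ℤ)))).natAbs = rad a b c := by
  sorry

/-- **C6b (S).** `PencilMemberBound ∧ Flt3Dispatch ⟹ abc with exponent 8`: given `ε₀`, apply the member bound
with `ε = 4ε₀`; role `(a, b)` captures `z = c`, roles `(c, −a)`, `(c, −b)` capture `z = b`, `z = a` (coprime to `c`
since `gcd(a, b) = 1`), one of which is `≥ c/2`; so `c² ≤ 4A·rad^{16+8ε₀}`, i.e. `c ≤ 2√A·rad^{8+4ε₀} <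
(2√A + 1)·rad^{8(1+ε₀)}` (`rad ≥ 1`, `Real.sqrt_le_sqrt`, `Real.rpow_natCast_mul`). [folklore] -/
theorem abcWithExponent_eight_of_pencilMemberBound (hmem : PencilMemberBound) (hdisp : Flt3Dispatch)
    (hrad : ∀ a b c : ℕ, IsABCTriple a b c →
      (radical ((a : ℤ) * b * ((a : ℤ) + b))).natAbs = rad a b c ∧
      (radical ((c : ℤ) * (-(a : ℤ)) * ((c : ℤ) + -(a : ℤ)))).natAbs = rad a b c ∧
      (radical ((c : ℤ) * (-(b : ℤ)) * ((c : ℤ) + -(b : ℤ)))).natAbs = rad a b c) :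
    GenEll.ABCWithExponent 8 := by
  sorry

/-- **Composition (kernel-checked).** The G6 recognition theorem, re-assembled from the new cut:
`Stub ⟹ abc with exponent 8`, given the ∀-helpers C1, T5, C4, T4a, T7 and the sign door. [folklore] -/
theorem abcWithExponent_eight_of_stub' (hirr : PencilIrreducible) (hcap : PencilCapture)
    (hcond : PencilConductor) (hstem : StemField) (hsign : SignDoor) (hdisp : Flt3Dispatch) (h : Stub) :
    GenEll.ABCWithExponent 8 :=
  abcWithExponent_eight_of_pencilMemberBound (pencilMemberBound_of_parts hirr hcap hcond hstem hsign h) hdisp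
    (fun _ _ _ ht => rad_roles ht)

/-- Sanity (kernel-checked): the route crux gives the stub. [folklore] -/
theorem stub_of_indexSzpiro (h : Summit.ABC.ABC.Theses.CubicResolventAllowance.IndexSzpiro) : Stub := by
  intro ε hε
  obtain ⟨C, hC⟩ := h ε hε
  exact ⟨C, fun W _ K _ _ hirr h3 hθ _ => hC W K hirr h3 hθ⟩

end Summit.ABC.ABC.Cruxes.IndexSzpiro.StubIdeas1G18

end
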